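import Mathlib
import HarnessLib

/-!
# Hydrodynamic bound via coercivity and Cauchy–Schwarz (stub `stub_hydroBound`)

Registered stub `stub_hydroBound` of the line `Sketch` (idea nash-doubling-debris) for the crux
`HoelderEscapeProfile.LocalEnergyHalfHoelder` (stmt-AtomisticToContinuum-16008).

Pure finite-dimensional algebra on the window `W := Finset.Icc (-L) L ⊂ ℤ`.
Given a coercive kernel `G` (with constant `χm > 0`), a vector `ap` solving the
normal equations `v y = ∑ x ∈ W, ap x * G (x - y)` on `W`, and `∑_W u² = ∑_W v²`,
we show `∑_W ap · u ≤ χm⁻¹ · ∑_W u²`.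

`Stmt.stub_hydroBound` below is a VERBATIM copy of the statement abbreviation of the skeleton
`Cruxes/LocalEnergyHalfHoelder/Lines/Sketch.lean` (namespace `…Theorems.LocalEnergyHalfHoelder.NashDoubling`
here, so the skeleton can import this file without name clashes); `stub_hydroBound` proves it and
`stub_hydroBound_explicit` restates it unfolded.
-/

open scoped BigOperators

namespace Summit.AtomisticToContinuum.FouriersLaw.Theorems.LocalEnergyHalfHoelder.NashDoubling

/-- Scalar core of the hydrodynamic bound: from `0 < χ`, `0 ≤ A`, `0 ≤ P`,
`(χ A)² ≤ A P` and `B² ≤ A P` conclude `B ≤ χ⁻¹ P`. -/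
theorem hydroBound_scalar {χ A P B : ℝ} (hχ : 0 < χ) (hA : 0 ≤ A) (hP : 0 ≤ P)
    (h4 : (χ * A) ^ 2 ≤ A * P) (h3 : B ^ 2 ≤ A * P) : B ≤ χ⁻¹ * P := by
  rw [inv_mul_eq_div, le_div_iff₀ hχ]
  rcases hA.eq_or_lt with hA0 | hApos
  · -- `A = 0`: then `B² ≤ 0`, so `B = 0`.
    have hB2 : B ^ 2 ≤ 0 := by simpa [← hA0] using h3
    have hB : B = 0 := pow_eq_zero_iff (n := 2) (by norm_num) |>.mp
      (le_antisymm hB2 (sq_nonneg B))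
    rw [hB, zero_mul]
    exact hP
  · -- `A > 0`: divide `(χ A)² ≤ A P` by `A` to get `χ² A ≤ P`.
    have h5 : χ ^ 2 * A ≤ P := by
      have h' : A * (χ ^ 2 * A) ≤ A * P := by
        calc A * (χ ^ 2 * A) = (χ * A) ^ 2 := by ring
          _ ≤ A * P := h4
      exact le_of_mul_le_mul_left h' hApos
    have h6 : (B * χ) ^ 2 ≤ P ^ 2 := by
      calc (B * χ) ^ 2 = B ^ 2 * χ ^ 2 := by ring
        _ ≤ A * P * χ ^ 2 := mul_le_mul_of_nonneg_right h3 (sq_nonneg _)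
        _ = (χ ^ 2 * A) * P := by ring
        _ ≤ P * P := mul_le_mul_of_nonneg_right h5 hP
        _ = P ^ 2 := by ring
    exact (abs_le_of_sq_le_sq' h6 hP).2

/-- **Statement of stub `stub_hydroBound`** (verbatim copy of the skeleton's `Stmt.stub_hydroBound`;
pure finite-dimensional algebra). If the Toeplitz-type form `a ↦ Σₓ Σ_y aₓ a_y G(y−x)` on the window
`[-L,L]` is coercive with constant `χm > 0` and `ap` solves the normal equations
`v_y = Σₓ apₓ G(x−y)`, then `Σₓ apₓ uₓ ≤ χm⁻¹ Σₓ uₓ²` whenever `Σ u² = Σ v²`. -/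
abbrev Stmt.stub_hydroBound : Prop :=
    ∀ (L : ℕ) (G u v ap : ℤ → ℝ) (χm : ℝ), 0 < χm → (∀ a : ℤ → ℝ, χm * ∑ x ∈ Finset.Icc (-(L:ℤ)) (L:ℤ), a x ^ 2 ≤ ∑ x ∈ Finset.Icc (-(L:ℤ)) (L:ℤ), ∑ y ∈ Finset.Icc (-(L:ℤ)) (L:ℤ), a x * a y * G (y - x)) → (∀ y ∈ Finset.Icc (-(L:ℤ)) (L:ℤ), v y = ∑ x ∈ Finset.Icc (-(L:ℤ)) (L:ℤ), ap x * G (x - y)) → ∑ x ∈ Finset.Icc (-(L:ℤ)) (L:ℤ), u x ^ 2 = ∑ x ∈ Finset.Icc (-(L:ℤ)) (L:ℤ), v x ^ 2 → ∑ x ∈ Finset.Icc (-(L:ℤ)) (L:ℤ), ap x * u x ≤ χm⁻¹ * ∑ x ∈ Finset.Icc (-(L:ℤ)) (L:ℤ), u x ^ 2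

/-- **Hydrodynamic bound (registered stub `stub_hydroBound`).** On the window
`W := Finset.Icc (-L) L`, assume the kernel `G` is coercive with constant `χm > 0`
(`χm · ∑_W a² ≤ ∑_W ∑_W a x · a y · G (y - x)` for every `a`), that `ap` solves the
normal equations `v y = ∑ x ∈ W, ap x * G (x - y)` for `y ∈ W`, and that
`∑_W u² = ∑_W v²`. Then `∑_W ap · u ≤ χm⁻¹ · ∑_W u²`.

Proof: coercivity at `a := ap` and the normal equations give
`χm · ∑ ap² ≤ ∑ ap · v`; Cauchy–Schwarz (`Finset.sum_mul_sq_le_sq_mul_sq`) bounds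
`(∑ ap · v)²` and `(∑ ap · u)²` by `(∑ ap²) (∑ u²)`, and `hydroBound_scalar` concludes. -/
theorem stub_hydroBound : Stmt.stub_hydroBound := by
  intro L G u v ap χm hχ hcoer hv huv
  -- Step 1: coercivity at `ap`, rewritten through the normal equations.
  have h1 : χm * ∑ x ∈ Finset.Icc (-(L:ℤ)) (L:ℤ), ap x ^ 2
      ≤ ∑ x ∈ Finset.Icc (-(L:ℤ)) (L:ℤ), ap x * v x := by
    calc χm * ∑ x ∈ Finset.Icc (-(L:ℤ)) (L:ℤ), ap x ^ 2
        ≤ ∑ x ∈ Finset.Icc (-(L:ℤ)) (L:ℤ), ∑ y ∈ Finset.Icc (-(L:ℤ)) (L:ℤ),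
            ap x * ap y * G (y - x) := hcoer ap
      _ = ∑ x ∈ Finset.Icc (-(L:ℤ)) (L:ℤ), ap x * v x := by
        refine Finset.sum_congr rfl ?_
        intro x hx
        rw [hv x hx, Finset.mul_sum]
        refine Finset.sum_congr rfl ?_
        intro y _
        ring
  -- Step 2: Cauchy–Schwarz for `∑ ap · v` and `∑ ap · u`.
  have h2 : (∑ x ∈ Finset.Icc (-(L:ℤ)) (L:ℤ), ap x * v x) ^ 2
      ≤ (∑ x ∈ Finset.Icc (-(L:ℤ)) (L:ℤ), ap x ^ 2)
        * ∑ x ∈ Finset.Icc (-(L:ℤ)) (L:ℤ), v x ^ 2 :=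
    Finset.sum_mul_sq_le_sq_mul_sq _ ap v
  have h3 : (∑ x ∈ Finset.Icc (-(L:ℤ)) (L:ℤ), ap x * u x) ^ 2
      ≤ (∑ x ∈ Finset.Icc (-(L:ℤ)) (L:ℤ), ap x ^ 2)
        * ∑ x ∈ Finset.Icc (-(L:ℤ)) (L:ℤ), u x ^ 2 :=
    Finset.sum_mul_sq_le_sq_mul_sq _ ap u
  rw [← huv] at h2
  have hA : 0 ≤ ∑ x ∈ Finset.Icc (-(L:ℤ)) (L:ℤ), ap x ^ 2 :=
    Finset.sum_nonneg (fun x _ => sq_nonneg _)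
  have hP : 0 ≤ ∑ x ∈ Finset.Icc (-(L:ℤ)) (L:ℤ), u x ^ 2 :=
    Finset.sum_nonneg (fun x _ => sq_nonneg _)
  -- Step 3: `(χm A)² ≤ (∑ ap v)² ≤ A P`, then the scalar lemma.
  have h4 : (χm * ∑ x ∈ Finset.Icc (-(L:ℤ)) (L:ℤ), ap x ^ 2) ^ 2
      ≤ (∑ x ∈ Finset.Icc (-(L:ℤ)) (L:ℤ), ap x ^ 2)
        * ∑ x ∈ Finset.Icc (-(L:ℤ)) (L:ℤ), u x ^ 2 :=
    le_trans (pow_le_pow_left₀ (mul_nonneg hχ.le hA) h1 2) h2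
  exact hydroBound_scalar hχ hA hP h4 h3

/-- **Hydrodynamic bound, unfolded form** (the statement of `Stmt.stub_hydroBound` written out;
definitionally the same as `stub_hydroBound`). -/
theorem stub_hydroBound_explicit : ∀ (L : ℕ) (G u v ap : ℤ → ℝ) (χm : ℝ), 0 < χm → (∀ a : ℤ → ℝ, χm * ∑ x ∈ Finset.Icc (-(L:ℤ)) (L:ℤ), a x ^ 2 ≤ ∑ x ∈ Finset.Icc (-(L:ℤ)) (L:ℤ), ∑ y ∈ Finset.Icc (-(L:ℤ)) (L:ℤ), a x * a y * G (y - x)) → (∀ y ∈ Finset.Icc (-(L:ℤ)) (L:ℤ), v y = ∑ x ∈ Finset.Icc (-(L:ℤ)) (L:ℤ), ap x * G (x - y)) → ∑ x ∈ Finset.Icc (-(L:ℤ)) (L:ℤ), u x ^ 2 = ∑ x ∈ Finset.Icc (-(L:ℤ)) (L:ℤ), v x ^ 2 → ∑ x ∈ Finset.Icc (-(L:ℤ)) (L:ℤ), ap x * u x ≤ χm⁻¹ * ∑ x ∈ Finset.Icc (-(L:ℤ)) (L:ℤ), u x ^ 2 :=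
  stub_hydroBound

end Summit.AtomisticToContinuum.FouriersLaw.Theorems.LocalEnergyHalfHoelder.NashDoubling
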